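import Summits.ABC.IUTFork.Cor312VolumesPadicPerm
import Summits.ABC.IUTFork.Cor312ThetaFiniteReal
import Summits.ABC.IUTFork.Thm311RealLattice
import Literature.IUT.LogVolume.TensorPacketShell
import HarnessLib

/-!
# [IUTchIII] Corollary 3.12, statement — the tensor-packet log-shell lattice through a `p`-adic presentation:
# STABLE preimage and BOUNDED image (the two inputs of "`−|log(Θ)| ∈ ℝ`" at a prime)

Record-only file (D-0012) of the abc-iut cell (Cor. 3.12 sub-crew, seat abc-iut-c312-7, gen 2; TEAM A row A-0 leftover
«ThetaFinite», `HOME/plan/C312-TEAMS.md`); TAKES NO SIDE. The first clause "`−|log(Θ)| ∈ ℝ`" of [IUTchIII] Cor. 3.12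
(S. Mochizuki, *Inter-universal Teichmüller theory III*, kurims manuscript `paper:url-4b091feeb646`, p. 174 l. 16;
proof p. 175 l. 2–4 "compactness of the `^{1,∘}𝒰_{j,v_ℚ}`") was reduced in `Cor312StatementStability` /
`Cor312ThetaFiniteReal` to, per packet `𝓘^ℚ(^{S^±_{j+1}};𝒟^⊢_{v_ℚ})`: an (Ind1)/(Ind2)-STABLE subset `W` containing the
(Ind3)-region whose image in the completed packet `⊕_i K_i` is BOUNDED. THIS file supplies both at a nonarchimedean
`v_ℚ = p` for the integral structure `I(^{S^±_{j+1}};𝒟^⊢_{v_ℚ}) = LogShells.shellPk` (c312-5, [IUTchIII] Prop. 3.2 (ii)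
p. 98) read through a `p`-ADIC PRESENTATION `P` of the carriers (c312-5 `Cor312Vol.PadicPresentation`: each
`log(𝒟^⊢_v) ≅ K_v` with `ℐ_v = c·log_p(𝒪^×_{K_v})`, [IUTchIII] Def. 1.1 (i); Dupuy–Hilado §4 `ℐ_v = (1/2p)·log(𝒪^×)`):

* `SummandPieces.image_preimage_image_eq_of_generatorsPreserve` — for ANY verbatim container `V` satisfying
  c312-5's generator hypotheses (`GeneratorsPreserve`: the (Ind1)/(Ind2) generators descend along the comparison
  `e`), a set `W` mapped onto itself by a family `Φ` gives an `e`-SATURATED set `e⁻¹(e(W)) ⊇ W` mapped onto itself by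
  `Φ` (descent ⟹ stability, `Cor312.image_preimage_eq_of_semiconj`) — no statement about the kernel of `e` is used;
* `PadicPresentation.comparison_mem_smul_logPacket` — the comparison `e : 𝓘^ℚ(−) → Π_{v⃗} X_{v⃗}` ([IUTchIII] Prop.
  3.1 (i)) carries the integral structure INTO `Π_{v⃗} c^{j+1}·log_p(R_{v⃗}^×)` (campaign-S `logPacket`, [IUTchIV]
  Prop. 1.2 p. 10 "`log_p(R_I^×) := ⊗ log_p(R_i^×)`"): a pure tensor of shell elements `⊗_a c·y_a` is
  `c^{j+1}·⊗_a y_a`;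
* `PadicPresentation.isBounded_sigmaFactor_image_shellPk` — hence, after abc-iut-c312-3's chosen field
  decompositions `ψ_{v⃗} : X_{v⃗} ≃ Π_i L_{v⃗,i}` ([IUTchIV] Prop. 1.4 (i)), the image of the integral structure in the
  direct sum of FIELDS `Π_{(v⃗,i)} L_{v⃗,i}` (the carrier of c312-7's real hull frame, `Cor312HullFrameReal`) is
  BOUNDED — it lies in the product of the coordinates of the compact sets `c^{j+1}·ψ_{v⃗}(log_p(R^×_{v⃗}))`
  (campaign-S `isCompact_imageLogPacket`, Dupuy–Hilado §4 intro "`I^{⊗ j+1}` is a `ℤ_p`-lattice");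
* the factor-side comparison `x ↦ (ψ_{v⃗}(e(x)_{v⃗})_i)_{(v⃗,i)}` (= seat c312-5's `PadicPresentation.factorMap`,
  `Cor312SettingDHVol`, spelled out here so as not to depend on that file) is onto and has the same saturated
  sets as `e` (`sigmaFactor_comparison_surjective`, `sigmaFactor_preimage_image`, `sigmaFactor_image_preimage_image`).
All statements are bookkeeping over LANDED decls of seats c312-5 / c312-3 and campaign S; the Dupuy–Hilado-level
instance (c312-5 `Real.settingDHVol`) is assembled by seat c312-5 (gen 3) — `Cor312VolumesPadicLattice` (the same
descent with the lattice family `latticePk c`, absorbing every bounded Θ-box), `Cor312HullDefinedDHVol`,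
`Cor312ThetaFiniteDHVol` — not here (A-0 re-cut of 2026-08-26T01:21:17Z; the dictionary between the two routes is
`Cor312ShellLatticeImage`: `e⁻¹(e(I(−))) = latticePk j ((c·2p)^{j+1})`).
[claim: Mochizuki2012, status: disputed] for the quoted objects; [cite: DupuyHilado2025, §4 intro, §4.7, §4.9];
[cite: Mochizuki2012, IUTchIV Prop. 1.2 p. 10, Prop. 1.4 (i) p. 13]. Deliberately NOT here: the Θ-boxes (owner
c312-3 `Ind3Datum`), log-volumes, archimedean places, any judgement.
-/

noncomputable section

open Set Function
open scoped Pointwise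

namespace Summit.ABC.IUTFork.Cor312Vol

open Thm311 Literature.IUT.LogThetaLattice Literature.IUT.LogVolume Literature.LinearAlgebra.BaseChange

variable {T : ThetaIndex}

/-! ## 1. Descent through a verbatim container: `e⁻¹(e(W))` is (Ind1)/(Ind2)-stable when `W` is -/

namespace SummandPieces

variable {L : LogShells T} (V : SummandPieces L)

/-- **Saturated stable sets.** If the container `V` satisfies c312-5's generator hypotheses (every (Ind1)/(Ind2)
generator is intertwined by the comparison `e` with a container-preserving bijection `Ψ`) and a family `Φ` maps
`W ⊆ 𝓘^ℚ(^{S^±_{j+1}};𝒟^⊢_{v_ℚ})` onto itself, then `Φ` maps the `e`-saturation `e⁻¹(e(W))` onto itself: `Ψ(e(W)) =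
e(Φ(W)) = e(W)`, then `Cor312.image_preimage_eq_of_semiconj`. [folklore] -/
theorem image_preimage_image_eq_of_generatorsPreserve (hG : V.GeneratorsPreserve) {j : T.Label} {vQ : T.VQ}
    {Φ : L.PacketAut} (hΦ : Φ ∈ L.Ind1Family ∪ L.Ind2Family) {W : Set (L.Packet j vQ)}
    (hW : Φ j vQ '' W = W) :
    Φ j vQ '' (V.e j vQ ⁻¹' (V.e j vQ '' W)) = V.e j vQ ⁻¹' (V.e j vQ '' W) := by
  obtain ⟨Ψ, hΨ, hcomm⟩ := hG.family hΦ j vQ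
  refine Cor312.image_preimage_eq_of_semiconj (Φ j vQ).surjective hΨ.bijective.1 hcomm ?_
  rw [← image_image_of_semiconj hcomm W, hW]

end SummandPieces

/-! ## 2. The integral structure through a `p`-adic presentation lands in `Π_{v⃗} c^{j+1}·log_p(R_{v⃗}^×)` -/

namespace PadicPresentation

variable {L : LogShells T} {vQ : T.VQ} {p : ℕ} [Fact p.Prime] (P : PadicPresentation L vQ p)

/-- Under the presentation `φ_v : log(𝒟^⊢_v) ≃ K_v` the subgroup generated by the log-shell lands in
`c·log_p(𝒪^×_{K_v})` (`shell_eq : φ_v(ℐ_v) = c·log_p(𝒪^×)`, and `log_p(𝒪^×)` is a subgroup — campaign-S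
`logUnitsAddSubgroup`). [claim: Mochizuki2012, status: disputed] -/
theorem φ_mem_smul_logUnits (v : T.Fibre vQ) {x : L.carrier v.1} (hx : x ∈ L.shellSubgroup v.1) :
    P.φ v x ∈ P.c • logUnits (P.k v) := by
  induction hx using AddSubgroup.closure_induction with
  | mem y hy =>
    rw [← P.shell_eq v]
    exact ⟨y, hy, rfl⟩
  | zero =>
    rw [map_zero, ← smul_zero P.c]
    exact Set.smul_mem_smul_set (zero_mem_logUnits (p := p))
  | add y z _ _ hy hz =>
    obtain ⟨a, ha, hya⟩ := Set.mem_smul_set.mp hy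
    obtain ⟨b, hb, hzb⟩ := Set.mem_smul_set.mp hz
    have hab : a + b ∈ logUnitsAddSubgroup p (P.k v) := (logUnitsAddSubgroup p (P.k v)).add_mem ha hb
    rw [map_add, ← hya, ← hzb, ← smul_add]
    exact Set.smul_mem_smul_set hab
  | neg y _ hy =>
    obtain ⟨a, ha, hya⟩ := Set.mem_smul_set.mp hy
    have hna : -a ∈ logUnitsAddSubgroup p (P.k v) := (logUnitsAddSubgroup p (P.k v)).neg_mem ha
    rw [map_neg, ← hya, ← smul_neg]
    exact Set.smul_mem_smul_set hna

/-- **A pure tensor of shell elements goes to `c^{j+1}·(pure tensor of log-units)`**: for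
`x_a ∈ ⟨ℐ_{v}⟩` (`a ∈ S^±_{j+1}`), `e(x_0 ⊗ ⋯ ⊗ x_j)_{v⃗} = ⊗_{ℚ_p,a} φ(x_{a,v⃗ a}) = c^{j+1}·⊗_a y_a` with
`y_a ∈ log_p(𝒪^×_{K_{v⃗ a}})`, an element of `c^{j+1}·log_p(R^×_{v⃗})` (campaign-S `logPacket`, [IUTchIV] Prop. 1.2).
[claim: Mochizuki2012, status: disputed] -/
theorem comparison_shellTensor_mem (j : T.Label) {x : T.Caps j → L.Packet1 vQ}
    (hx : ∀ a (v : T.Fibre vQ), x a v ∈ L.shellSubgroup v.1) (e : T.Caps j → T.Fibre vQ) :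
    P.comparison j (L.tprod j vQ x) e ∈ (P.c ^ ((j : ℕ) + 1)) • (logPacket p (P.kk e) : Set (P.X e)) := by
  choose y hy hyx using fun a => Set.mem_smul_set.mp (P.φ_mem_smul_logUnits (e a) (hx a (e a)))
  have h1 : P.comparison j (L.tprod j vQ x) e = purePacket p (P.kk e) fun a => P.c • y a := by
    rw [show L.tprod j vQ x = PiTensorProduct.tprod ℚ x from rfl, P.comparison_tprod]
    show PiTensorProduct.tprod ℚ_[p] _ = PiTensorProduct.tprod ℚ_[p] _
    congr 1
    funext a
    exact (hyx a).symm
  have h2 : purePacket p (P.kk e) (fun a => P.c • y a) = (P.c ^ ((j : ℕ) + 1)) • purePacket p (P.kk e) y := by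
    rw [show (fun a => P.c • y a) = (fun a => (fun _ : T.Caps j => P.c) a • y a) from rfl, purePacket_smul]
    simp only [Finset.prod_const, Finset.card_univ, Fintype.card_fin]
  rw [h1, h2]
  exact Set.smul_mem_smul_set (AddSubgroup.subset_closure ⟨y, hy, rfl⟩)

/-- **The integral structure `I(^{S^±_{j+1}};𝒟^⊢_{v_ℚ})` goes INTO `Π_{v⃗} c^{j+1}·log_p(R^×_{v⃗})`** under the comparison
`e` (the subgroup generated by the shell tensors; `e` is additive and the targets are subgroups).
[claim: Mochizuki2012, status: disputed] -/
theorem comparison_mem_smul_logPacket (j : T.Label) {x : L.Packet j vQ} (hx : x ∈ L.shellPk j vQ)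
    (e : T.Caps j → T.Fibre vQ) :
    P.comparison j x e ∈ (P.c ^ ((j : ℕ) + 1)) • (logPacket p (P.kk e) : Set (P.X e)) := by
  rw [LogShells.shellPk_eq_closure] at hx
  induction hx using AddSubgroup.closure_induction with
  | mem t ht =>
    obtain ⟨x, hx, rfl⟩ := ht
    exact P.comparison_shellTensor_mem j hx e
  | zero =>
    rw [map_zero, Pi.zero_apply, ← smul_zero (P.c ^ ((j : ℕ) + 1))]
    exact Set.smul_mem_smul_set (logPacket p (P.kk e)).zero_mem
  | add y z _ _ hy hz =>
    obtain ⟨a, ha, hya⟩ := Set.mem_smul_set.mp hy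
    obtain ⟨b, hb, hzb⟩ := Set.mem_smul_set.mp hz
    have hab : a + b ∈ logPacket p (P.kk e) := (logPacket p (P.kk e)).add_mem ha hb
    rw [map_add, Pi.add_apply, ← hya, ← hzb, ← smul_add]
    exact Set.smul_mem_smul_set hab
  | neg y _ hy =>
    obtain ⟨a, ha, hya⟩ := Set.mem_smul_set.mp hy
    have hna : -a ∈ logPacket p (P.kk e) := (logPacket p (P.kk e)).neg_mem ha
    rw [map_neg, Pi.neg_apply, ← hya, ← smul_neg]
    exact Set.smul_mem_smul_set hna

/-! ## 3. Through the chosen field decompositions `ψ_{v⃗} : X_{v⃗} ≃ Π_i L_{v⃗,i}` (abc-iut-c312-3 `dEquiv`) -/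

/-- **The image of the integral structure in the direct sum of fields `Π_{(v⃗,i)} L_{v⃗,i}` is BOUNDED** (it lies in the
product over `(v⃗, i)` of the `i`-th coordinates of the compact sets `c^{j+1}·ψ_{v⃗}(log_p(R^×_{v⃗}))`, campaign-S
`isCompact_imageLogPacket`): the boundedness input of c312-7's `hullDefined_of_stable` for the factor-side
comparison of seat c312-5's `Cor312SettingDHVol` (spelled `x ↦ (ψ_{v⃗}(e(x)_{v⃗})_i)`). Dupuy–Hilado §4 intro: the
tensor-product log-shell `I^{⊗ j+1}` is a `ℤ_p`-lattice. [cite: DupuyHilado2025, §4 (intro)] -/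
theorem isBounded_sigmaFactor_image_shellPk (j : T.Label) :
    Bornology.IsBounded ((fun (x : L.Packet j vQ) (s : Σ e : T.Caps j → T.Fibre vQ, DIdx p (P.kk e)) =>
      dEquiv p (P.kk s.1) (P.comparison j x s.1) s.2) '' (L.shellPk j vQ : Set (L.Packet j vQ))) := by
  classical
  haveI : Fintype (T.Fibre vQ) := Fintype.ofFinite _
  have hC : ∀ e : T.Caps j → T.Fibre vQ,
      IsCompact ((P.c ^ ((j : ℕ) + 1)) • (imageLogPacket p (P.kk e) : Set (DSum p (P.kk e)))) :=
    fun e => (isCompact_imageLogPacket p (P.kk e)).smul _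
  refine (Bornology.IsBounded.pi fun s : (Σ e : T.Caps j → T.Fibre vQ, DIdx p (P.kk e)) =>
    ((hC s.1).image (continuous_apply s.2)).isBounded).subset ?_
  rintro _ ⟨x, hx, rfl⟩
  rw [Set.mem_univ_pi]
  intro s
  obtain ⟨z, hz, hzx⟩ := P.comparison_mem_smul_logPacket j hx s.1
  refine ⟨dEquiv p (P.kk s.1) (P.comparison j x s.1), ?_, rfl⟩
  rw [← hzx, map_smul]
  refine Set.smul_mem_smul_set ?_
  rw [coe_imageLogPacket]
  exact ⟨z, hz, rfl⟩

/-- The factor-side comparison `x ↦ (ψ_{v⃗}(e(x)_{v⃗})_i)_{(v⃗,i)}` is ONTO (`e` is onto, c312-5 `comparison_surjective`;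
each `ψ_{v⃗}` is a bijection). [folklore] -/
theorem sigmaFactor_comparison_surjective (j : T.Label) :
    Function.Surjective (fun (x : L.Packet j vQ) (s : Σ e : T.Caps j → T.Fibre vQ, DIdx p (P.kk e)) =>
      dEquiv p (P.kk s.1) (P.comparison j x s.1) s.2) := by
  intro y
  obtain ⟨x, hx⟩ := P.comparison_surjective j (fun e => (dEquiv p (P.kk e)).symm fun i => y ⟨e, i⟩)
  refine ⟨x, funext fun s => ?_⟩
  simp only [hx, AlgEquiv.apply_symm_apply]

/-- The factor-side comparison has the same saturated sets as `e`: `(ψ∘e)⁻¹((ψ∘e)(W)) = e⁻¹(e(W))` (`ψ` injective).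
[folklore] -/
theorem sigmaFactor_preimage_image (j : T.Label) (W : Set (L.Packet j vQ)) :
    (fun (x : L.Packet j vQ) (s : Σ e : T.Caps j → T.Fibre vQ, DIdx p (P.kk e)) =>
        dEquiv p (P.kk s.1) (P.comparison j x s.1) s.2) ⁻¹'
      ((fun (x : L.Packet j vQ) (s : Σ e : T.Caps j → T.Fibre vQ, DIdx p (P.kk e)) =>
        dEquiv p (P.kk s.1) (P.comparison j x s.1) s.2) '' W) =
      P.comparison j ⁻¹' (P.comparison j '' W) := by
  ext x
  simp only [Set.mem_preimage, Set.mem_image]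
  constructor
  · rintro ⟨y, hy, hyx⟩
    refine ⟨y, hy, funext fun e => (dEquiv p (P.kk e)).injective (funext fun i => ?_)⟩
    exact congrFun hyx ⟨e, i⟩
  · rintro ⟨y, hy, hyx⟩
    exact ⟨y, hy, funext fun s => by rw [hyx]⟩

/-- … so the factor-side image of the saturation `e⁻¹(e(W))` is the factor-side image of `W`. [folklore] -/
theorem sigmaFactor_image_preimage_image (j : T.Label) (W : Set (L.Packet j vQ)) :
    (fun (x : L.Packet j vQ) (s : Σ e : T.Caps j → T.Fibre vQ, DIdx p (P.kk e)) =>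
        dEquiv p (P.kk s.1) (P.comparison j x s.1) s.2) '' (P.comparison j ⁻¹' (P.comparison j '' W)) =
      (fun (x : L.Packet j vQ) (s : Σ e : T.Caps j → T.Fibre vQ, DIdx p (P.kk e)) =>
        dEquiv p (P.kk s.1) (P.comparison j x s.1) s.2) '' W := by
  rw [← P.sigmaFactor_preimage_image j W, Set.image_preimage_eq_inter_range,
    Set.inter_eq_left.mpr (Set.image_subset_range _ _)]

/-- The stable saturated lattice `W_p := e⁻¹(e(I(^{S^±_{j+1}};𝒟^⊢_{v_ℚ})))` CONTAINS the integral structure. [folklore] -/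
theorem shellPk_subset_preimage_image (j : T.Label) :
    (L.shellPk j vQ : Set (L.Packet j vQ)) ⊆ P.comparison j ⁻¹' (P.comparison j '' (L.shellPk j vQ : Set _)) :=
  Set.subset_preimage_image _ _

/-- **Stability of `W_p` under the (Ind1)/(Ind2) families for a `p`-adic presentation**: the container
`P.toLocalPieces` satisfies the generator hypotheses (c312-5 `generatorsPreserve_toLocalPieces`, PROVED), so a
family mapping the integral structure onto itself (c312-5 `image_shellPk_of_mem_Ind1/2`: strip automorphisms and
`Ism` preserve the shells) maps `W_p` onto itself. [cite: DupuyHilado2025, §4.7, §4.9] -/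
theorem image_preimage_image_shellPk (j : T.Label) {Φ : L.PacketAut} (hΦ : Φ ∈ L.Ind1Family ∪ L.Ind2Family)
    (hS : Φ j vQ '' (L.shellPk j vQ : Set (L.Packet j vQ)) = L.shellPk j vQ) :
    Φ j vQ '' (P.comparison j ⁻¹' (P.comparison j '' (L.shellPk j vQ : Set _))) =
      P.comparison j ⁻¹' (P.comparison j '' (L.shellPk j vQ : Set _)) := by
  obtain ⟨Ψ, hΨ, hcomm⟩ : ∃ Ψ : (∀ e : T.Caps j → T.Fibre vQ, P.X e) → ∀ e : T.Caps j → T.Fibre vQ, P.X e,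
      Function.Injective Ψ ∧ ∀ x, P.comparison j (Φ j vQ x) = Ψ (P.comparison j x) := by
    rcases hΦ with hΦ | hΦ
    · obtain ⟨σ, h, hh, hΦj⟩ := hΦ j
      obtain ⟨ΨP, hΨP, hcommP⟩ := P.generatorsPreserve_toLocalPieces.perm j σ
      obtain ⟨ΨS, hΨS, hcommS⟩ :=
        P.generatorsPreserve_toLocalPieces.strip j (fun i v => h i v.1) fun i v => hh i v.1
      refine ⟨ΨS ∘ ΨP, hΨS.bijective.1.comp hΨP.bijective.1, fun x => ?_⟩
      have hΦj' : Φ j vQ = (L.permute j vQ σ).trans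
          (L.factorwise j vQ fun i => L.summandwise vQ fun v => h i v.1) := hΦj vQ
      have hx : Φ j vQ x = L.factorwise j vQ (fun i => L.summandwise vQ fun v => h i v.1)
          (L.permute j vQ σ x) := by
        rw [hΦj']; rfl
      rw [hx]
      exact (hcommS _).trans (congrArg ΨS (hcommP x))
    · obtain ⟨g, hg, hΦj⟩ := hΦ j vQ
      obtain ⟨Ψ, hΨ, hcomm⟩ := P.generatorsPreserve_toLocalPieces.ism j g hg
      exact ⟨Ψ, hΨ.bijective.1, fun x => by rw [hΦj]; exact hcomm x⟩
  refine Cor312.image_preimage_eq_of_semiconj (Φ j vQ).surjective hΨ hcomm ?_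
  have himg : P.comparison j '' (Φ j vQ '' (L.shellPk j vQ : Set _)) = Ψ '' (P.comparison j '' (L.shellPk j vQ : Set _)) := by
    rw [Set.image_image, Set.image_image]
    exact Set.image_congr fun x _ => hcomm x
  rw [← himg, hS]

end PadicPresentation

end Summit.ABC.IUTFork.Cor312Vol

end
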